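import Literature.ComputerArithmetic.JeannerodRump2018.Theorem41

/-!
# Lange–Rump 2019: unit in the first place, node bookkeeping (toolkit for Propositions 1 and 3)

HONEST FRAMING (venture CertifiedArithmetic / cell `pub-lowprec`): certified error envelopes and
provably optimal rounding/accumulation schemes for low-precision formats under stated cost models;
every table by two implementations; no hardware or vendor claims.

Setting of [LangeRump2018, §2] (M. Lange and S. M. Rump, *Sharp estimates for perturbation
errors in summations*, Math. Comp. 88 (2019) 349–368), restricted to radix `β = 2` and typed over
the number system of `JeannerodRump2018/Summation.lean`: `F` = `IsFloat p emin` (precision `p`,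
gradual underflow, no overflow), `fl` = any round-to-nearest map (`IsRoundNearest`), `u = 2^-p`,
evaluation orders = `SumTree`. This file provides the quantities the proofs of Propositions 1 and
3 (files `Proposition1.lean`, `Proposition3.lean`) are organised around:
* `ufp p emin t` — the paper's `ufp(t)` ("largest power of β less than or equal to |t|",
  [LangeRump2018, proof of Prop 1]), as a rational, set to `0` on the exact range
  `|t| < 2^(emin+p)` where a sum of two floats is itself a float; the nearest-addition facts
  `|fl(a+b) - (a+b)| ≤ u·ufp(a+b)` ("the difference between two successive numbers is never
  greater than the ufp", [LangeRump2018, p. 10]), `ufp ∈ F`, `ufp(t) ≤ |t|`, hence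
  `|fl(a+b) - (a+b)| + ufp(a+b) ≤ |a+b|`, and the radix-2 discreteness of ufp values
  (`b_j ∈ {0} ∪ {2^m}` in [LangeRump2018, (21)]): `ufp t < ufp t' ⇒ 2 ufp t ≤ ufp t'`;
* per-node bookkeeping over `SumTree` (`numNodes` = `n - 1` additions, `AllNodes`/`SomeNode`,
  `maxUfp`) and the cap lemma `Σ|δ_v| ≤ numNodes·u·C`;
* the two arithmetic bookkeeping steps of the induction for Proposition 1.
-/

namespace Literature.ComputerArithmetic.LangeRump2018

open Literature.ComputerArithmetic.JeannerodRump2018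
open Literature.ComputerArithmetic.JeannerodRump2018.SumTree

variable {p : ℕ} {emin : ℤ} {fl : ℚ → ℚ}

/-! ### `ufp`, truncated to `0` on the exact range -/

/-- `ufp(t)`: the largest power of two `≤ |t|`, for `|t| ≥ 2^(emin+p)`; `0` below (where sums of
two floats are exact). [cite: LangeRump2018, §3 (proof of Prop 1)] -/
noncomputable def ufp (p : ℕ) (emin : ℤ) (t : ℚ) : ℚ :=
  if |t| < (2 : ℚ) ^ (emin + p) then 0 else (2 : ℚ) ^ (Int.log 2 |t|)

/-- `ufp ≥ 0`. [cite: LangeRump2018, §3] -/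
theorem ufp_nonneg (p : ℕ) (emin : ℤ) (t : ℚ) : 0 ≤ ufp p emin t := by
  unfold ufp; split_ifs
  · exact le_rfl
  · exact (zpow_pos (by norm_num) _).le

/-- `ufp` depends on `|t|` only. [cite: LangeRump2018, §3] -/
theorem ufp_neg (p : ℕ) (emin : ℤ) (t : ℚ) : ufp p emin (-t) = ufp p emin t := by
  unfold ufp; rw [abs_neg]

/-- `ufp(t) ≤ |t|`. [cite: LangeRump2018, §3] -/
theorem ufp_le_abs (p : ℕ) (emin : ℤ) (t : ℚ) : ufp p emin t ≤ |t| := by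
  unfold ufp
  split_ifs with h
  · exact abs_nonneg t
  · have hpos : 0 < |t| := lt_of_lt_of_le (zpow_pos (by norm_num) _) (not_lt.mp h)
    have := Int.zpow_log_le_self (b := 2) (by norm_num) hpos
    exact_mod_cast this

/-- In the rounding range the binary logarithm is at least `emin + p`. [cite: LangeRump2018, §3] -/
theorem log_ge_of_le {t : ℚ} (ht : (2 : ℚ) ^ (emin + p) ≤ |t|) : emin + p ≤ Int.log 2 |t| := by
  by_contra hlt
  have hlt : Int.log 2 |t| + 1 ≤ emin + p := by omega
  have hup : |t| < ((2 : ℕ) : ℚ) ^ (Int.log 2 |t| + 1) := Int.lt_zpow_succ_log_self (by norm_num) |t|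
  push_cast at hup
  have : (2 : ℚ) ^ (Int.log 2 |t| + 1) ≤ (2 : ℚ) ^ (emin + (p : ℤ)) :=
    zpow_le_zpow_right₀ (by norm_num) hlt
  linarith

/-- A power of two `2^k` with `k ≥ emin + p - 1` is a float (`= 2^(p-1) · 2^(k+1-p)`).
[cite: LangeRump2018, §3] -/
theorem isFloat_zpow (hp : 1 ≤ p) {k : ℤ} (hk : emin + p ≤ k + 1) :
    IsFloat p emin ((2 : ℚ) ^ k) := by
  refine ⟨2 ^ (p - 1), k + 1 - p, ?_, by omega, ?_⟩
  · rw [abs_of_nonneg (by positivity)]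
    exact_mod_cast Nat.pow_lt_pow_right (by norm_num) (by omega : p - 1 < p)
  · have : ((2 ^ (p - 1) : ℤ) : ℚ) = (2 : ℚ) ^ (((p - 1 : ℕ) : ℤ)) := by
      rw [zpow_natCast]; push_cast; ring
    rw [this, ← zpow_add₀ (by norm_num : (2 : ℚ) ≠ 0)]
    congr 1; omega

/-- `ufp(t) ∈ F`. [cite: LangeRump2018, §3 ("µ ∈ F")] -/
theorem isFloat_ufp (hp : 1 ≤ p) (t : ℚ) : IsFloat p emin (ufp p emin t) := by
  unfold ufp
  split_ifs with h
  · exact isFloat_zero p emin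
  · exact isFloat_zpow hp (by have := log_ge_of_le (p := p) (not_lt.mp h); omega)

/-- HALF AN ULP, positive normal-range argument: `2^(emin+p) ≤ t ⟹ |t - fl t| ≤ u · 2^⌊log₂ t⌋`
(the two neighbours `m·2^(k+1-p)`, `(m+1)·2^(k+1-p)` of `t` are floats).
[cite: LangeRump2018, p. 10 ("|δₖ| ≤ ufp/2·…")] -/
theorem abs_sub_fl_le_ufp_pos (hp : 1 ≤ p) (hfl : IsRoundNearest p emin fl) {t : ℚ}
    (ht : (2 : ℚ) ^ (emin + p) ≤ t) :
    |t - fl t| ≤ unitRoundoff p * (2 : ℚ) ^ (Int.log 2 t) := by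
  have h2 : (2 : ℚ) ≠ 0 := by norm_num
  have htpos : 0 < t := lt_of_lt_of_le (zpow_pos (by norm_num) _) ht
  set k := Int.log 2 t with hk
  have hlow : ((2 : ℕ) : ℚ) ^ k ≤ t := Int.zpow_log_le_self (by norm_num) htpos
  have hup : t < ((2 : ℕ) : ℚ) ^ (k + 1) := Int.lt_zpow_succ_log_self (by norm_num) t
  push_cast at hlow hup
  have hk_ge : emin + p ≤ k := by
    have := log_ge_of_le (p := p) (emin := emin) (t := t) (by rwa [abs_of_pos htpos])
    rwa [abs_of_pos htpos] at this
  set c : ℚ := (2 : ℚ) ^ (k + 1 - p) with hc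
  have hcpos : 0 < c := zpow_pos (by norm_num) _
  have hg : (2 : ℚ) ^ k = (2 : ℚ) ^ ((p : ℤ) - 1) * c := by
    rw [hc, ← zpow_add₀ h2]; congr 1; ring
  have hg2 : (2 : ℚ) ^ (k + 1) = (2 : ℚ) ^ (p : ℤ) * c := by
    rw [hc, ← zpow_add₀ h2]; congr 1; ring
  set m := ⌊t / c⌋ with hm
  have hm_le : (m : ℚ) ≤ t / c := Int.floor_le _
  have hm_lt : t / c < m + 1 := Int.lt_floor_add_one _
  have hm_ge : (2 ^ (p - 1) : ℤ) ≤ m := by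
    rw [hm, Int.le_floor]; push_cast
    rw [le_div_iff₀ hcpos]
    have : ((2 : ℕ) : ℚ) ^ (p - 1) * c = (2 : ℚ) ^ k := by
      rw [hg, show ((p : ℤ) - 1) = ((p - 1 : ℕ) : ℤ) by omega, zpow_natCast]; push_cast; ring
    push_cast at this; linarith
  have hm_lt' : m < (2 ^ p : ℤ) := by
    rw [hm, Int.floor_lt]; push_cast
    rw [div_lt_iff₀ hcpos]
    have : ((2 : ℕ) : ℚ) ^ p * c = (2 : ℚ) ^ (k + 1) := by rw [hg2, zpow_natCast]; push_cast; ring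
    push_cast at this; linarith
  have hm0 : (0 : ℤ) ≤ m := le_trans (by positivity) hm_ge
  have hf1 : IsFloat p emin ((m : ℚ) * c) := by
    refine ⟨m, k + 1 - p, ?_, by omega, rfl⟩
    rw [abs_of_nonneg hm0]; exact hm_lt'
  have hf2 : IsFloat p emin (((m + 1 : ℤ) : ℚ) * c) := by
    rcases lt_or_eq_of_le (Int.add_one_le_iff.mpr hm_lt') with hlt | heq
    · refine ⟨m + 1, k + 1 - p, ?_, by omega, rfl⟩
      rw [abs_of_nonneg (by linarith)]; exact hlt
    · rw [heq]; push_cast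
      have : (2 : ℚ) ^ p * c = (2 : ℚ) ^ (k + 1) := by rw [hg2, zpow_natCast]
      rw [this]
      exact isFloat_zpow hp (by omega)
  have e1 := abs_sub_fl_le hfl t hf1
  have e2 := abs_sub_fl_le hfl t hf2
  have hf1le : (m : ℚ) * c ≤ t := by rwa [le_div_iff₀ hcpos] at hm_le
  have hf2ge : t ≤ ((m + 1 : ℤ) : ℚ) * c := by
    push_cast; rw [div_lt_iff₀ hcpos] at hm_lt; linarith
  rw [abs_of_nonneg (by linarith : 0 ≤ t - m * c)] at e1
  rw [abs_of_nonpos (by linarith : t - ((m + 1 : ℤ) : ℚ) * c ≤ 0)] at e2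
  push_cast at e2
  have hu : unitRoundoff p * (2 : ℚ) ^ k = c / 2 := by
    unfold unitRoundoff
    rw [hc, show (k + 1 - (p : ℤ)) = k + 1 + (-(p : ℤ)) by ring, zpow_add₀ h2, zpow_add₀ h2,
      zpow_neg, zpow_natCast, zpow_one]
    field_simp
  rw [hu]; linarith

/-- HALF AN ULP for a sum of two floats (gradual underflow included): `|fl(a+b) - (a+b)| ≤
u · ufp(a+b)` — exact below `2^(emin+p)`, half the spacing `2u·ufp` above.
[cite: LangeRump2018, p. 10] -/
theorem abs_err_add_le_ufp (hp : 1 ≤ p) (hfl : IsRoundNearest p emin fl) {a b : ℚ}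
    (ha : IsFloat p emin a) (hb : IsFloat p emin b) :
    |fl (a + b) - (a + b)| ≤ unitRoundoff p * ufp p emin (a + b) := by
  set t := a + b with ht
  unfold ufp
  split_ifs with hsmall
  · rw [fl_eq_self hfl (isFloat_add_of_small ha hb hsmall), sub_self, abs_zero, mul_zero]
  · have hbig : (2 : ℚ) ^ (emin + p) ≤ |t| := not_lt.mp hsmall
    rcases lt_or_ge t 0 with hneg | hnn
    · have h := abs_sub_fl_le_ufp_pos hp hfl.neg (t := -t) (by rwa [abs_of_neg hneg] at hbig)
      simp only [neg_neg] at h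
      rw [abs_of_neg hneg, abs_sub_comm]
      rw [show |t - fl t| = |-t - -fl t| by rw [← abs_neg]; ring_nf]
      exact h
    · have h := abs_sub_fl_le_ufp_pos hp hfl (t := t) (by rwa [abs_of_nonneg hnn] at hbig)
      rw [abs_of_nonneg hnn, abs_sub_comm]; exact h

/-- `ufp` values are `0` or powers of two, hence ordered by doubling:
`ufp t < ufp t' ⇒ 2·ufp t ≤ ufp t'`. [cite: LangeRump2018, (21)] -/
theorem two_mul_ufp_le_of_lt {t t' : ℚ} (hlt : ufp p emin t < ufp p emin t') :
    2 * ufp p emin t ≤ ufp p emin t' := by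
  unfold ufp at hlt ⊢
  split_ifs at hlt ⊢ with h1 h2 h2
  · simp at hlt
  · rw [mul_zero]; exact (zpow_pos (by norm_num) _).le
  · exfalso; have : (0 : ℚ) < (2 : ℚ) ^ Int.log 2 |t| := zpow_pos (by norm_num) _; linarith
  · have hkk : Int.log 2 |t| < Int.log 2 |t'| := (zpow_lt_zpow_iff_right₀ (by norm_num)).mp hlt
    rw [show (2 : ℚ) * 2 ^ Int.log 2 |t| = 2 ^ (Int.log 2 |t| + 1) by
      rw [zpow_add₀ (by norm_num), zpow_one]; ring]
    exact zpow_le_zpow_right₀ (by norm_num) (by omega)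

/-- Quadrupling order: `2·ufp t < ufp t' ⇒ 4·ufp t ≤ ufp t'`. [cite: LangeRump2018, (21)] -/
theorem four_mul_ufp_le_of_lt {t t' : ℚ} (hlt : 2 * ufp p emin t < ufp p emin t') :
    4 * ufp p emin t ≤ ufp p emin t' := by
  unfold ufp at hlt ⊢
  split_ifs at hlt ⊢ with h1 h2 h2
  · simp at hlt
  · rw [mul_zero]; exact (zpow_pos (by norm_num) _).le
  · exfalso; have : (0 : ℚ) < (2 : ℚ) ^ Int.log 2 |t| := zpow_pos (by norm_num) _; linarith
  · have hlt' : (2 : ℚ) ^ (Int.log 2 |t| + 1) < 2 ^ Int.log 2 |t'| := by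
      rw [zpow_add₀ (by norm_num), zpow_one]; linarith
    have hkk : Int.log 2 |t| + 1 < Int.log 2 |t'| := (zpow_lt_zpow_iff_right₀ (by norm_num)).mp hlt'
    rw [show (4 : ℚ) * 2 ^ Int.log 2 |t| = 2 ^ (Int.log 2 |t| + 2) by
      rw [zpow_add₀ (by norm_num)]; norm_num; ring]
    exact zpow_le_zpow_right₀ (by norm_num) (by omega)

/-- KEY LOCAL FACT: the error AND the floor fit inside the argument,
`|fl(a+b) - (a+b)| + ufp(a+b) ≤ |a+b|` (`±ufp ∈ F` is a rounding candidate at distance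
`|a+b| - ufp`). [cite: LangeRump2018, §3 (Lemma 6 / proof of Prop 1)] -/
theorem abs_err_add_ufp_le_abs (hp : 1 ≤ p) (hfl : IsRoundNearest p emin fl) (a b : ℚ) :
    |fl (a + b) - (a + b)| + ufp p emin (a + b) ≤ |a + b| := by
  set y := a + b with hy
  have hU := ufp_le_abs p emin y
  have hU0 := ufp_nonneg p emin y
  have hF := isFloat_ufp (emin := emin) hp y
  by_cases hsgn : 0 ≤ y
  · have hn := abs_sub_fl_le hfl y hF
    rw [abs_of_nonneg hsgn] at hU ⊢
    rw [abs_sub_comm] at hn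
    have : |y - ufp p emin y| = y - ufp p emin y := abs_of_nonneg (by linarith)
    linarith
  · have hn := abs_sub_fl_le hfl y hF.neg
    have hyneg : y < 0 := not_le.mp hsgn
    rw [abs_of_neg hyneg] at hU ⊢
    rw [abs_sub_comm] at hn
    have : |y - -ufp p emin y| = -y - ufp p emin y := by
      rw [sub_neg_eq_add, abs_of_nonpos (by linarith)]; ring
    linarith

/-! ### Trees: node counts, node predicates, the maximal ufp -/

/-- Number of internal nodes (additions) of an evaluation tree. [cite: LangeRump2018, §3 (`N_r`)] -/
def numNodes : SumTree → ℕ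
  | .leaf _ => 0
  | .node l r => numNodes l + numNodes r + 1

/-- `numNodes t + 1 = n`. [cite: LangeRump2018, §3] -/
theorem numNodes_add_one : ∀ t : SumTree, numNodes t + 1 = t.leaves.length
  | .leaf _ => rfl
  | .node l r => by
      simp only [numNodes, SumTree.leaves, List.length_append, ← numNodes_add_one l,
        ← numNodes_add_one r]
      omega

/-- `(numNodes t : ℚ) = n - 1`. [cite: LangeRump2018, §3] -/
theorem numNodes_cast (t : SumTree) : (numNodes t : ℚ) = (t.leaves.length : ℚ) - 1 := by
  rw [← numNodes_add_one t]; push_cast; ring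

/-- Every internal node's exact argument satisfies `P`. [cite: LangeRump2018, §3] -/
def AllNodes (fl : ℚ → ℚ) (P : ℚ → Prop) : SumTree → Prop
  | .leaf _ => True
  | .node l r => AllNodes fl P l ∧ AllNodes fl P r ∧ P (eval fl l + eval fl r)

/-- Some internal node's exact argument satisfies `P`. [cite: LangeRump2018, §3] -/
def SomeNode (fl : ℚ → ℚ) (P : ℚ → Prop) : SumTree → Prop
  | .leaf _ => False
  | .node l r => SomeNode fl P l ∨ SomeNode fl P r ∨ P (eval fl l + eval fl r)

/-- `AllNodes` is monotone. [cite: LangeRump2018, §3] -/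
theorem AllNodes.mono {P Q : ℚ → Prop} (hPQ : ∀ y, P y → Q y) :
    ∀ t : SumTree, AllNodes fl P t → AllNodes fl Q t
  | .leaf _, _ => trivial
  | .node l r, ⟨hl, hr, hroot⟩ => ⟨AllNodes.mono hPQ l hl, AllNodes.mono hPQ r hr, hPQ _ hroot⟩

/-- `AllNodes P` and no node with `Q` give `AllNodes (P ∧ ¬Q)`. [cite: LangeRump2018, §3] -/
theorem AllNodes.and_not {P Q : ℚ → Prop} :
    ∀ t : SumTree, AllNodes fl P t → ¬ SomeNode fl Q t → AllNodes fl (fun y => P y ∧ ¬ Q y) t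
  | .leaf _, _, _ => trivial
  | .node l r, ⟨hl, hr, hroot⟩, hno => by
      simp only [SomeNode, not_or] at hno
      exact ⟨AllNodes.and_not l hl hno.1, AllNodes.and_not r hr hno.2.1, hroot, hno.2.2⟩

/-- The largest `ufp` over the internal nodes' arguments (`0` for a leaf).
[cite: LangeRump2018, §3 (`τ`, `µ`)] -/
noncomputable def maxUfp (p : ℕ) (emin : ℤ) (fl : ℚ → ℚ) : SumTree → ℚ
  | .leaf _ => 0
  | .node l r => max (max (maxUfp p emin fl l) (maxUfp p emin fl r))
      (ufp p emin (eval fl l + eval fl r))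

/-- Every node's `ufp` is at most `maxUfp`. [cite: LangeRump2018, §3] -/
theorem allNodes_ufp_le_maxUfp :
    ∀ t : SumTree, AllNodes fl (fun y => ufp p emin y ≤ maxUfp p emin fl t) t
  | .leaf _ => trivial
  | .node l r => by
      refine ⟨AllNodes.mono (fun y hy => ?_) l (allNodes_ufp_le_maxUfp l),
        AllNodes.mono (fun y hy => ?_) r (allNodes_ufp_le_maxUfp r), ?_⟩
      · exact le_trans hy (le_trans (le_max_left _ _) (le_max_left _ _))
      · exact le_trans hy (le_trans (le_max_right _ _) (le_max_left _ _))
      · exact le_max_right _ _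

/-- `maxUfp` is attained at some node when there is one. [cite: LangeRump2018, §3] -/
theorem someNode_ufp_eq_maxUfp :
    ∀ t : SumTree, 0 < numNodes t → SomeNode fl (fun y => ufp p emin y = maxUfp p emin fl t) t
  | .leaf _, h => by simp [numNodes] at h
  | .node a b, _ => by
      simp only [SomeNode, maxUfp]
      set R := ufp p emin (eval fl a + eval fl b)
      by_cases hR : max (maxUfp p emin fl a) (maxUfp p emin fl b) ≤ R
      · right; right; exact (max_eq_right hR).symm
      · have hR' : R < max (maxUfp p emin fl a) (maxUfp p emin fl b) := not_le.mp hR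
        rw [max_eq_left hR'.le]
        have hpos : 0 < max (maxUfp p emin fl a) (maxUfp p emin fl b) :=
          lt_of_le_of_lt (ufp_nonneg p emin _) hR'
        rcases le_total (maxUfp p emin fl b) (maxUfp p emin fl a) with hab | hab
        · rw [max_eq_left hab] at hpos ⊢
          have ha : 0 < numNodes a := by
            cases a with
            | leaf x => simp [maxUfp] at hpos
            | node _ _ => simp [numNodes]
          left; exact someNode_ufp_eq_maxUfp a ha
        · rw [max_eq_right hab] at hpos ⊢
          have hb : 0 < numNodes b := by
            cases b with
            | leaf x => simp [maxUfp] at hpos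
            | node _ _ => simp [numNodes]
          right; left; exact someNode_ufp_eq_maxUfp b hb

/-- CAP LEMMA: if every node's `ufp` is `≤ C` then `Σ|δ_v| ≤ numNodes·u·C` (leaves in `F`).
[cite: LangeRump2018, §3] -/
theorem absErr_le_numNodes_mul (hp : 1 ≤ p) (hfl : IsRoundNearest p emin fl) {C : ℚ} :
    ∀ t : SumTree, (∀ x ∈ t.leaves, IsFloat p emin x) → AllNodes fl (fun y => ufp p emin y ≤ C) t →
      absErr fl t ≤ (numNodes t : ℚ) * (unitRoundoff p * C)
  | .leaf x, _, _ => by simp [absErr, SumTree.localErrors, numNodes]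
  | .node l r, hleaves, ⟨hal, har, hroot⟩ => by
      have hl : ∀ x ∈ l.leaves, IsFloat p emin x := fun x hx => hleaves x (by simp [leaves, hx])
      have hr : ∀ x ∈ r.leaves, IsFloat p emin x := fun x hx => hleaves x (by simp [leaves, hx])
      have ihl := absErr_le_numNodes_mul hp hfl l hl hal
      have ihr := absErr_le_numNodes_mul hp hfl r hr har
      have he := abs_err_add_le_ufp hp hfl (isFloat_eval hfl l hl) (isFloat_eval hfl r hr)
      have hupos : 0 < unitRoundoff p := by unfold unitRoundoff; positivity
      have : unitRoundoff p * ufp p emin (eval fl l + eval fl r) ≤ unitRoundoff p * C :=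
        mul_le_mul_of_nonneg_left hroot hupos.le
      rw [absErr_node]
      simp only [numNodes]
      push_cast
      linarith

/-! ### The two bookkeeping inequalities of Proposition 1's induction (pure arithmetic) -/

/-- At the node of maximal ufp: `D₀ ≤ m·u·U/2`, `e ≤ uU`, `U + e - D₀ ≤ T`, `2Ku ≤ 1` give
`D₀ + e - Ku/(1+Ku)·T ≤ -(K - m - 1)·uU/(1+Ku)`. [cite: LangeRump2018, Thm 5] -/
theorem base_arith {u U D₀ e T : ℚ} {m K : ℕ} (hu : 0 < u)
    (hK : 2 * (K : ℚ) * u ≤ 1) (hmK : m + 1 ≤ K) (hD₀0 : 0 ≤ D₀)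
    (hD₀ : D₀ ≤ (m : ℚ) * (u * (U / 2))) (he : e ≤ u * U) (hT : U + e - D₀ ≤ T) :
    D₀ + e - (K : ℚ) * u / (1 + (K : ℚ) * u) * T
      ≤ -(((K : ℚ) - (m + 1)) * (u * U) / (1 + (K : ℚ) * u)) := by
  have hK0 : (0 : ℚ) ≤ K := Nat.cast_nonneg K
  have hKu : 0 ≤ (K : ℚ) * u := mul_nonneg hK0 hu.le
  have hden : 0 < 1 + (K : ℚ) * u := by linarith
  rw [div_mul_eq_mul_div, sub_le_iff_le_add, ← neg_div, ← add_div, le_div_iff₀ hden]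
  have h1 : (K : ℚ) * u * (U + e - D₀) ≤ (K : ℚ) * u * T := mul_le_mul_of_nonneg_left hT hKu
  have h2 : 2 * (K : ℚ) * u * D₀ ≤ D₀ := by nlinarith
  have hmK' : (m : ℚ) + 1 ≤ K := by exact_mod_cast hmK
  nlinarith

/-- At an ancestor: a disjoint subtree (`k_B` additions, mass `T`, error `D ≤ k_B u/(1+k_B u)·T`)
joined with error `e ≤ min(T + D, uU)` consumes at most `(k_B+1)·uU/(1+Ku)` of slack.
[cite: LangeRump2018, Thm 5] -/
theorem step_arith {u U D T e : ℚ} {kB K : ℕ} (hu : 0 < u) (hu2 : 2 * u ≤ 1)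
    (hU : 0 ≤ U) (hK : 2 * (K : ℚ) * u ≤ 1) (hkBK : kB ≤ K) (hT : 0 ≤ T) (hD0 : 0 ≤ D)
    (hD : D ≤ (kB : ℚ) * u / (1 + (kB : ℚ) * u) * T) (he1 : e ≤ T + D)
    (he2 : e ≤ u * U) :
    D + e - (K : ℚ) * u / (1 + (K : ℚ) * u) * T
      ≤ ((kB : ℚ) + 1) * (u * U) / (1 + (K : ℚ) * u) := by
  have hK0 : (0 : ℚ) ≤ K := Nat.cast_nonneg K
  have hkB0 : (0 : ℚ) ≤ kB := Nat.cast_nonneg kB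
  have hKu : 0 ≤ (K : ℚ) * u := mul_nonneg hK0 hu.le
  have hkBu : 0 ≤ (kB : ℚ) * u := mul_nonneg hkB0 hu.le
  have hden : 0 < 1 + (K : ℚ) * u := by linarith
  have hdenB : 0 < 1 + (kB : ℚ) * u := by linarith
  have hkBK' : (kB : ℚ) ≤ K := by exact_mod_cast hkBK
  have huU : 0 ≤ u * U := mul_nonneg hu.le hU
  have hD' : D * (1 + (kB : ℚ) * u) ≤ (kB : ℚ) * u * T := by
    rw [div_mul_eq_mul_div, le_div_iff₀ hdenB] at hD; exact hD
  have hDT : D ≤ (kB : ℚ) * u * T := by nlinarith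
  have hDleT : D ≤ T := by
    have : (kB : ℚ) * u * T ≤ (1 + (kB : ℚ) * u) * T := by nlinarith
    nlinarith
  have hKD : (1 + (K : ℚ) * u) * D ≤ (K : ℚ) * u * T := by
    have : 0 ≤ ((K : ℚ) - kB) * u * (T - D) :=
      mul_nonneg (mul_nonneg (by linarith) hu.le) (by linarith)
    nlinarith
  rw [div_mul_eq_mul_div, sub_le_iff_le_add, ← add_div, le_div_iff₀ hden]
  by_cases hc : u * U ≤ T + D
  · rcases Nat.eq_zero_or_pos kB with hk0 | hk1
    · subst hk0
      have hD0' : D = 0 := le_antisymm (by simpa using hD') hD0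
      subst hD0'
      have p1 : 0 ≤ (u * U - e) * (1 + (K : ℚ) * u) := mul_nonneg (by linarith) hden.le
      have p2 : 0 ≤ (K : ℚ) * u * (T - u * U) := mul_nonneg hKu (by linarith)
      push_cast
      nlinarith
    · have hk1' : (1 : ℚ) ≤ kB := by exact_mod_cast hk1
      have p3 : e * (1 + (K : ℚ) * u) ≤ u * U * (1 + (K : ℚ) * u) :=
        mul_le_mul_of_nonneg_right he2 hden.le
      have p4 : (K : ℚ) * u * (u * U) ≤ (kB : ℚ) * (u * U) :=
        mul_le_mul_of_nonneg_right (by linarith) huU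
      nlinarith
  · have hc' : T + D < u * U := not_le.mp hc
    have p5 : e * (1 + (K : ℚ) * u) ≤ (T + D) * (1 + (K : ℚ) * u) :=
      mul_le_mul_of_nonneg_right he1 hden.le
    have p6 : 2 * (K : ℚ) * u * D ≤ D := by nlinarith
    have p7 : (kB : ℚ) * u * T ≤ (kB : ℚ) * u * (u * U) :=
      mul_le_mul_of_nonneg_left (by linarith) hkBu
    have p8 : (kB : ℚ) * u * (u * U) * 2 ≤ (kB : ℚ) * (u * U) := by nlinarith
    nlinarith

end Literature.ComputerArithmetic.LangeRump2018
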